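import Summits.QuantumFields.GaugeBoot.PlanarRelaxationFunctionalCut
import Summits.QuantumFields.GaugeBoot.WordSpaces
import Summits.QuantumFields.GaugeBoot.LatticeWords
import HarnessLib

/-!
# Loop variables of length `≤ n` are level-`n` test functions; the resolved relaxation block is implied by the level-`n` word SDP (gauge-boot, large-`N` supplement 15, rider 2 — item (lxvi), concrete half)

HONEST FRAMING (cell `pub-gaugeboot`, page 1 of every file): the venture produces certified bounds
on lattice expectations at stated coupling, gauge group, dimension and torus size; NOT a mass gap,
NOT a continuum limit, NOT a string tension; NOT large `N` unless marked CONDITIONAL; NOT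
Yang–Mills-summit-bearing (barriers `FixedCouplingUltralocality`, `PerturbativeInvisibility`).
Algebra only; this file certifies no number.

## Content

On the torus `(ℤ/L)^d` with configurations `GaugeConfig d L G = Edge d L → G` and a faithful unitary
representation `r : LatticeRep G` (the lane's word-SDP vocabulary, `WordSpaces.lean`):

* ★ `entriesIn_wordHolonomy` — the matrix entries of `r.ρ (hol_x(w)(U))` of a WORD `w` of length `n` are word
  functions of degree `n` (induction on the word with `entriesIn_rho`, `entriesIn_rho_inv`, `EntriesIn.mul`);
  `reTrWordCM r x w`, `imTrWordCM r x w` — `Re tr ρ(hol_x(w))`, `Im tr ρ(hol_x(w))` as continuous observables;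
  ★★ `reTrWordCM_mem_wordTruncation` / `imTrWordCM_mem_wordTruncation` — **they are level-`n` test functions
  of the word-length truncation for every `n ≥ |w|`** (so are the normalised loop variables
  `(1/N) Re tr`, `wordLoopCM`);
* ★★★ `isRelaxationFeasible_wordLoops_of_isBootstrapFeasible` — **for every feasible point `φ` of the lane's
  level-`n` word SDP (`IsBootstrapFeasible r k S β (wordTruncation r n) φ`) and every finite family of words
  `ℓ_A` of length `≤ n`, Kazakov–Zheng's relaxation block in the orientation-resolved wiring,
  `W_A = φ((1/N) Re tr hol(ℓ_A))`, `Q_{AB} = φ((1/N²)(Re tr_A Re tr_B + Im tr_A Im tr_B))` (`= φ (1/N²) Re(tr_A conj tr_B)`),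
  is feasible**: `[[1, Wᵀ], [W, Q]] ⪰ 0` is a CONSEQUENCE of the positivity the finite-`N` SDP already
  imposes — adding it as a cut changes nothing (item (lxvi) of the binder, now closed: abstract half in
  `PlanarRelaxationFunctionalCut.lean`, concrete half here).

[folklore] (Kazakov–Zheng arXiv:2404.16925 §3.1; the lane's `WordSpaces` bookkeeping).
-/

noncomputable section

open scoped BigOperators
open Literature.MathematicalPhysics.QuantumFieldTheory (LatticeRep Edge Site GaugeConfig)

namespace Summit.QuantumFields.GaugeBoot

variable {d L : ℕ} {G : Type*} [Group G] [TopologicalSpace G] (r : LatticeRep G)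

/-! ## The entries of a word holonomy are word functions of the word's length -/

/-- The identity matrix has entries in every word space (constants). [folklore] -/
theorem entriesIn_one (S : Set (Edge d L)) (n : ℕ) : EntriesIn r S n (fun _ : GaugeConfig d L G => (1 : Matrix (Fin r.N) (Fin r.N) ℂ)) := by
  intro a b
  by_cases h : a = b
  · subst h
    refine ⟨?_, ?_⟩
    · have e : (fun _ : GaugeConfig d L G => ((1 : Matrix (Fin r.N) (Fin r.N) ℂ) a a).re) = fun _ => (1 : ℝ) := by
        funext U; simp
      rw [e]; exact const_mem_wordFunctions r S n 1
    · have e : (fun _ : GaugeConfig d L G => ((1 : Matrix (Fin r.N) (Fin r.N) ℂ) a a).im) = fun _ => (0 : ℝ) := by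
        funext U; simp
      rw [e]; exact const_mem_wordFunctions r S n 0
  · refine ⟨?_, ?_⟩
    · have e : (fun _ : GaugeConfig d L G => ((1 : Matrix (Fin r.N) (Fin r.N) ℂ) a b).re) = fun _ => (0 : ℝ) := by
        funext U; simp [Matrix.one_apply_ne h]
      rw [e]; exact const_mem_wordFunctions r S n 0
    · have e : (fun _ : GaugeConfig d L G => ((1 : Matrix (Fin r.N) (Fin r.N) ℂ) a b).im) = fun _ => (0 : ℝ) := by
        funext U; simp [Matrix.one_apply_ne h]
      rw [e]; exact const_mem_wordFunctions r S n 0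

/-- A step holonomy has entries in degree `1` (`U_e` forward, `U_e⁻¹ = U_eᴴ` backward). [folklore] -/
theorem entriesIn_stepHolonomy (x : Site d L) (s : Step d) :
    EntriesIn r (Set.univ : Set (Edge d L)) 1 (fun U : GaugeConfig d L G => r.ρ (stepHolonomy U x s)) := by
  cases s with
  | fwd μ => exact entriesIn_rho r (Set.mem_univ (x, μ)) le_rfl
  | bwd μ => exact entriesIn_rho_inv r (Set.mem_univ (x - Pi.single μ 1, μ)) le_rfl

/-- ★ **The entries of `ρ(hol_x(w))` are word functions of degree `|w|`.** [folklore] -/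
theorem entriesIn_wordHolonomy : ∀ (x : Site d L) (w : Word d),
    EntriesIn r (Set.univ : Set (Edge d L)) w.length (fun U : GaugeConfig d L G => r.ρ (wordHolonomy U x w))
  | x, [] => by
    simpa only [wordHolonomy_nil, map_one, List.length_nil] using entriesIn_one r (Set.univ : Set (Edge d L)) 0
  | x, s :: w => by
    have h := (entriesIn_stepHolonomy r x s).mul r (entriesIn_wordHolonomy (s.apply x) w)
    rw [Nat.add_comm] at h
    simpa only [wordHolonomy_cons, map_mul, List.length_cons] using h

/-- `Im tr` of a matrix observable with entries in a word space is in the word space. [folklore] -/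
theorem EntriesIn.trace_im {ι : Type*} {S : Set ι} {n : ℕ} {M : (ι → G) → Matrix (Fin r.N) (Fin r.N) ℂ}
    (hM : EntriesIn r S n M) : (fun U => (M U).trace.im) ∈ wordFunctions r S n := by
  have h : (fun U => (M U).trace.im) = ∑ a, fun U => (M U a a).im := by
    funext U
    simp [Matrix.trace, Complex.im_sum, Finset.sum_apply]
  rw [h]
  exact Submodule.sum_mem _ fun a _ => (hM a a).2

/-- `Re tr ρ(hol_x(w))` is a word function of degree `|w|`. [folklore] -/
theorem reTr_wordHolonomy_mem_wordFunctions (x : Site d L) (w : Word d) :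
    (fun U : GaugeConfig d L G => (r.ρ (wordHolonomy U x w)).trace.re) ∈ wordFunctions r (Set.univ : Set (Edge d L)) w.length :=
  (entriesIn_wordHolonomy r x w).trace_re

/-- `Im tr ρ(hol_x(w))` is a word function of degree `|w|`. [folklore] -/
theorem imTr_wordHolonomy_mem_wordFunctions (x : Site d L) (w : Word d) :
    (fun U : GaugeConfig d L G => (r.ρ (wordHolonomy U x w)).trace.im) ∈ wordFunctions r (Set.univ : Set (Edge d L)) w.length :=
  (entriesIn_wordHolonomy r x w).trace_im r

/-! ## The loop observables as level-`n` test functions -/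

/-- **`Re tr ρ(hol_x(w))` as a continuous observable.** [folklore] -/
def reTrWordCM (x : Site d L) (w : Word d) : C(GaugeConfig d L G, ℝ) :=
  ⟨fun U => (r.ρ (wordHolonomy U x w)).trace.re, by
    obtain ⟨g, -, hg⟩ := (mem_wordFunctions_iff r).1 (reTr_wordHolonomy_mem_wordFunctions r x w)
    rw [← hg]; exact g.continuous⟩

/-- **`Im tr ρ(hol_x(w))` as a continuous observable.** [folklore] -/
def imTrWordCM (x : Site d L) (w : Word d) : C(GaugeConfig d L G, ℝ) :=
  ⟨fun U => (r.ρ (wordHolonomy U x w)).trace.im, by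
    obtain ⟨g, -, hg⟩ := (mem_wordFunctions_iff r).1 (imTr_wordHolonomy_mem_wordFunctions r x w)
    rw [← hg]; exact g.continuous⟩

/-- Evaluation. [folklore] -/
@[simp] theorem reTrWordCM_apply (x : Site d L) (w : Word d) (U : GaugeConfig d L G) :
    reTrWordCM r x w U = (r.ρ (wordHolonomy U x w)).trace.re := rfl

/-- Evaluation. [folklore] -/
@[simp] theorem imTrWordCM_apply (x : Site d L) (w : Word d) (U : GaugeConfig d L G) :
    imTrWordCM r x w U = (r.ρ (wordHolonomy U x w)).trace.im := rfl

/-- ★★ **`Re tr ρ(hol_x(w))` is a level-`n` test function for every `n ≥ |w|`.** [folklore] -/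
theorem reTrWordCM_mem_wordTruncation (x : Site d L) (w : Word d) {n : ℕ} (hn : w.length ≤ n) :
    reTrWordCM r x w ∈ wordTruncation (ι := Edge d L) r n :=
  wordTruncation_mono r hn (mem_wordTruncation_of_mem_wordSpace r
    ((coe_mem_wordFunctions_iff r).1 (reTr_wordHolonomy_mem_wordFunctions r x w)))

/-- ★★ **`Im tr ρ(hol_x(w))` is a level-`n` test function for every `n ≥ |w|`.** [folklore] -/
theorem imTrWordCM_mem_wordTruncation (x : Site d L) (w : Word d) {n : ℕ} (hn : w.length ≤ n) :
    imTrWordCM r x w ∈ wordTruncation (ι := Edge d L) r n :=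
  wordTruncation_mono r hn (mem_wordTruncation_of_mem_wordSpace r
    ((coe_mem_wordFunctions_iff r).1 (imTr_wordHolonomy_mem_wordFunctions r x w)))

/-- **The normalised loop variable `(1/N) Re tr ρ(hol_x(w))` as a continuous observable** (the lane's `wordLoop`). [folklore] -/
def wordLoopCM (x : Site d L) (w : Word d) : C(GaugeConfig d L G, ℝ) := (r.N : ℝ)⁻¹ • reTrWordCM r x w

/-- `wordLoopCM` is the lane's `wordLoop`. [folklore] -/
theorem wordLoopCM_apply (x : Site d L) (w : Word d) (U : GaugeConfig d L G) : wordLoopCM r x w U = wordLoop r.ρ x w U := by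
  rw [wordLoopCM, ContinuousMap.smul_apply, reTrWordCM_apply, wordLoop_apply, smul_eq_mul]

/-- The normalised loop variable is a level-`n` test function for every `n ≥ |w|`. [folklore] -/
theorem wordLoopCM_mem_wordTruncation (x : Site d L) (w : Word d) {n : ℕ} (hn : w.length ≤ n) :
    wordLoopCM r x w ∈ wordTruncation (ι := Edge d L) r n :=
  Submodule.smul_mem _ _ (reTrWordCM_mem_wordTruncation r x w hn)

/-! ## The resolved relaxation block is implied by the level-`n` word SDP -/

section Cut

variable {K : Type*} {k : K → ℝ → G} {S : Edge d L → (GaugeConfig d L G) → ℝ} {β : ℝ} {ι : Type*} [Fintype ι]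

/-- ★★★ **KZ's relaxation block (orientation-resolved wiring, trace normalisation) is a consequence of the
level-`n` word SDP**: for every `φ` feasible at word level `n` and words `ℓ_A` of length `≤ n` based at `x`,
`IsRelaxationFeasible W Q` with `W_A = φ(Re tr hol(ℓ_A))`, `Q_{AB} = φ(Re tr_A · Re tr_B + Im tr_A · Im tr_B)`.
[folklore] -/
theorem isRelaxationFeasible_reTr_of_isBootstrapFeasible {n : ℕ} {φ : C(GaugeConfig d L G, ℝ) →ₗ[ℝ] ℝ}
    (hφ : IsBootstrapFeasible r k S β (wordTruncation (ι := Edge d L) r n) φ) (x : Site d L) (ℓ : ι → Word d)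
    (hℓ : ∀ A, (ℓ A).length ≤ n) :
    IsRelaxationFeasible (fun A => φ (reTrWordCM r x (ℓ A)))
      (fun A B => φ (reTrWordCM r x (ℓ A) * reTrWordCM r x (ℓ B) + imTrWordCM r x (ℓ A) * imTrWordCM r x (ℓ B))) :=
  isRelaxationFeasible_of_isBootstrapFeasible_wordTruncation r hφ (fun A => reTrWordCM r x (ℓ A)) (fun A => imTrWordCM r x (ℓ A))
    (fun A => reTrWordCM_mem_wordTruncation r x (ℓ A) (hℓ A)) (fun A => imTrWordCM_mem_wordTruncation r x (ℓ A) (hℓ A))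

/-- ★★★ **The same with the loop-variable normalisation `1/N`**: `W_A = φ((1/N) Re tr hol(ℓ_A)) = φ(wordLoop)`,
`Q_{AB} = φ((1/N²)(Re tr_A Re tr_B + Im tr_A Im tr_B))` — exactly the resolved planar block of supplement 15
evaluated on a level-`n` functional instead of a state. [folklore] -/
theorem isRelaxationFeasible_wordLoops_of_isBootstrapFeasible {n : ℕ} {φ : C(GaugeConfig d L G, ℝ) →ₗ[ℝ] ℝ}
    (hφ : IsBootstrapFeasible r k S β (wordTruncation (ι := Edge d L) r n) φ) (x : Site d L) (ℓ : ι → Word d)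
    (hℓ : ∀ A, (ℓ A).length ≤ n) :
    IsRelaxationFeasible (fun A => φ (wordLoopCM r x (ℓ A)))
      (fun A B => φ (wordLoopCM r x (ℓ A) * wordLoopCM r x (ℓ B) +
        ((r.N : ℝ)⁻¹ • imTrWordCM r x (ℓ A)) * ((r.N : ℝ)⁻¹ • imTrWordCM r x (ℓ B)))) :=
  isRelaxationFeasible_of_isBootstrapFeasible_wordTruncation r hφ (fun A => wordLoopCM r x (ℓ A))
    (fun A => (r.N : ℝ)⁻¹ • imTrWordCM r x (ℓ A)) (fun A => wordLoopCM_mem_wordTruncation r x (ℓ A) (hℓ A))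
    (fun A => Submodule.smul_mem _ _ (imTrWordCM_mem_wordTruncation r x (ℓ A) (hℓ A)))

end Cut

end Summit.QuantumFields.GaugeBoot

end
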